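import Summits.QuantumFields.YangMills.Theorems.BalabanUVNodesN14WindowOscillationLedger

/-!
# DAG node N14 (NE1′) — AT A BOUNDED WINDOW THE N14 DESCENT COSTS THE OLD-HISTORY LAW-MERGE LETTER: FILE 7's two descent roads unified in product form
# (rate `η + 2ρᶜ·ω`), the kernel dichotomy «window growth OR summable law merge», and a two-run Dirac window toy where neither holds and no coarse binder is summable

Cell `pub-ymgap` (HUMAN RULING D-0062, Track A; D-0149 width push), WIDTH SEAT `pub-ymgap-dag-n14-w2` (NODE n14 = NE1′), generation 7, FILE 12; `--kind proof --supports
stmt-QuantumFields-27366 --as helper` (K3⁸ `SpineGivenEndpointR13SepCoPHV`, KEY MAP v2; helper, NOT a discharge; count-neutral).  THEOREMS ONLY (0 `def`, 0 `instance`,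
0 `notation`, 0 `sorry`).  ADDITIVE — imports this seat's FILE 11 `…N14WindowOscillationLedger` (p641013; through it FILE 8∕7∕1 of the lineage: `tiltedMean_push_eq_condAvg`,
`sum_abs_sub_le_two_mul_of_forall_subset`, `fibreOsc_le_tail_of_windowLedger`, `le_dirac_ledger_tail`; NE1′'s `tiltedMean`, `MGFForm`, `TiltedMeanMatching`)
ONLY — CITED BY NAME; modifies nothing.

WHY.  g6 FILE 7 priced the descent of N14's binder `TiltedMeanMatching` to a coarser key along TWO roads: fine binder + ONE-RUN fibre oscillation
(`tiltedMeanMatching_push_of_fibreOsc`, rate `η + ω`) and fine binder + the TWO-RUN conditional class-law TV inside each coarse class (`…_push_of_condClassLawTV`, rate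
`η + 2Bρᶜ`, «the useless one at history → window»).  FILE 11 booked `ω` at the WINDOW key as the tail of NE1′'s one-run old budget, `2volE·a^{j⋆(K)}∕(1−a)`: summable iff
the window GROWS (`j⋆(K) ≥ c·log K`), and for a bounded window no summable `ω` exists.  THIS FILE records the escape hatch a bounded window still has, and closes it in a toy:
* §1 [pure sums] ★ `abs_condAvg_sub_condAvg_le_of_tv_mul_osc` — two conditional laws `p, q` on one fibre at ℓ¹-distance `≤ 2ρ`, fine means `η`-close, run A's fine means
  oscillating by `≤ ω` ⇒ `|Σq·m′ − Σp·m| ≤ η + 2ρ·ω` (the transport term is `Σ(q − p)(m − m(τ₀))`).  FILE 7's two bounds are the cases `ρ ≤ 1` and `ω ≤ 2B`.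
* §2 [the unified road] ★★ `tiltedMeanMatching_push_of_condClassLawTV_mul_fibreOsc` — N14's binder descends to ANY coarser key at rate `η_K + 2ρᶜ_K·ω_K` (FILE 7's
  `tiltedMean_push_eq_condAvg` + FILE 1's `sum_abs_sub_le_two_mul_of_forall_subset` BY NAME).
* §3 [at the window key] ★★★ `tiltedMeanMatching_window_of_fineBinder_of_condClassLawTV_of_windowLedger` — with FILE 11's window ledger: rate
  `η_K + 2ρᶜ_K·(2volE·a^{j⋆(K)}∕(1−a))`; ★ `summable_windowRate_of_growth_or_lawMerge` — THE DICHOTOMY in kernel form: that rate is summable if `Σ η < ∞` and EITHER the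
  window grows (`Σ_K a^{j⋆(K)} < ∞`, FILE 11 §4) OR the two runs' conditional laws of OLD history given the window class MERGE summably (`Σ_K ρᶜ_K < ∞`) — for ANY window,
  bounded included.
* §4 [sharpness: a bounded window WITHOUT law merge] the TWO-RUN DIRAC WINDOW TOY on the two-point fibre: both runs' fine class pieces are positive multiples of the SAME
  Dirac masses at `±S_K` (`S_K` = FILE 11's old tail ≥ `E·b^{j⋆(K)}`), so the FINE binder is EXACT (dag-n14-c's `YMDAG.N14.ConvexFibreMatching.tiltedMean_smul_measure` + FILE 11's `tiltedMean_dirac`: `η = 0`), but run A weights the classes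
  `(1−ε, ε)` and run B `(ε, 1−ε)`: the coarse (window-keyed) undressed means are `±(1−2ε)S_K` (`tiltedMean_zero_twoPoint`), the conditional laws stay `(1−2ε)`-SEPARATED, and
  ★ `not_summable_coarseBinder_of_dirac_window_toy`: with a window bounded along a subsequence NO rate bounding the coarse mismatch at `s = 0` is summable.  So at a bounded
  (1.80)-window the N14 side needs the old-history LAW-MERGE letter — the negation side (LS) that CRIT-1's triage of `window-key-core` isolated for the N19′∕N20 faces — or
  the window must grow as in FILE 11 (`κ₁ > 1∕(2 ln L)` in the caricature's `d = 4` numbers).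

HONEST FRAMING.  [folklore] finite-sum bookkeeping and two-point measure theory BY NAME on hypothesis SHAPES and a TOY; `η`, `ω`, `ρᶜ`, the window ledger are letters produced by
nobody for Bałaban's runs (his class-conditioned laws are not products∕Dirac masses; which letter holds at the (1.80) window — growth, law merge, or neither — is undecided
physics, NODE O's object); `wkey` is not declared at Stage 13; proves NO estimate of the programme; nothing of Bałaban's asserted or instantiated; NE1′ ∕ NE7 ∕ NE7b NOT PRINTED
as two-run statements for `d = 4`, NOT proved; N14 ∕ N19 ∕ N20 NOT discharged; K3⁸ OPEN (v6 untouched), K3⁷ aside; counts UNMOVED.  One finite 𝕋⁴ programme at fixed `ε`;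
R4 closes only the CONDITIONAL finite-𝕋⁴ rung `BalabanLadder.UV` — NOT ℝ⁴, NOT OS, NOT the Yang–Mills mass gap (Clay), which is NOT proved by any of this.
-/

noncomputable section

open MeasureTheory ProbabilityTheory Finset Filter

namespace YMDAG.N14.WindowDescentLawMerge

open Summit.QuantumFields.BalabanUV.T4Continuum.NE1p.DressedMGFForm (tiltedMean MGFForm TiltedMeanMatching)
open Summit.QuantumFields.BalabanUV.T4Continuum.Spine.NE7 (QLa)
open YMDAG.N14.TargetOfBinderAndClassLawTV (sum_abs_sub_le_two_mul_of_forall_subset)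
open YMDAG.N14.BinderKeyCoarsening (tiltedMean_push_eq_condAvg)
open YMDAG.N14.WindowOscillationLedger (fibreOsc_le_tail_of_windowLedger le_dirac_ledger_tail)

/-! ## §1 Pure sums: the transport term costs the conditional-law TV TIMES the fibre oscillation -/

section Sums

variable {ι : Type*}

/-- ★ **TWO CONDITIONAL LAWS, PRODUCT FORM.**  On one fibre `S`: conditional laws `p, q` (`q ≥ 0`, totals `1`) at ℓ¹-distance `≤ 2ρ`; fine means `m, m′` with
`|m′ − m| ≤ η` pointwise; run A's means `m` oscillating by at most `ω` over the fibre.  Then `|Σ q·m′ − Σ p·m| ≤ η + 2ρ·ω` — the transport term is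
`Σ (q − p)·(m − m(τ₀))` for any base point `τ₀ ∈ S`.  FILE 7's `…_le_of_osc` (`η + ω`) and FILE 1's transport bound (`2B·ρ`) are the cases `Σ|q − p| ≤ 2` and
`|m| ≤ B`. [folklore] -/
theorem abs_condAvg_sub_condAvg_le_of_tv_mul_osc {S : Finset ι} {p q m m' : ι → ℝ} {η ω ρ : ℝ} (hq : ∀ τ ∈ S, 0 ≤ q τ)
    (hp1 : ∑ τ ∈ S, p τ = 1) (hq1 : ∑ τ ∈ S, q τ = 1) (hη : ∀ τ ∈ S, |m' τ - m τ| ≤ η)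
    (hω : ∀ τ ∈ S, ∀ τ' ∈ S, |m τ - m τ'| ≤ ω) (hρ : ∑ τ ∈ S, |q τ - p τ| ≤ 2 * ρ) :
    |∑ τ ∈ S, q τ * m' τ - ∑ τ ∈ S, p τ * m τ| ≤ η + 2 * ρ * ω := by
  have hne : S.Nonempty := by
    by_contra h
    rw [not_nonempty_iff_eq_empty] at h
    rw [h, sum_empty] at hp1
    exact zero_ne_one hp1
  obtain ⟨τ₀, hτ₀⟩ := hne
  have h3 : ∑ τ ∈ S, (q τ - p τ) * m τ₀ = 0 := by
    rw [← sum_mul, sum_sub_distrib, hq1, hp1, sub_self, zero_mul]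
  have hsplit : ∑ τ ∈ S, q τ * m' τ - ∑ τ ∈ S, p τ * m τ
      = ∑ τ ∈ S, q τ * (m' τ - m τ) + ∑ τ ∈ S, (q τ - p τ) * (m τ - m τ₀) := by
    calc ∑ τ ∈ S, q τ * m' τ - ∑ τ ∈ S, p τ * m τ = ∑ τ ∈ S, (q τ * m' τ - p τ * m τ) := by rw [sum_sub_distrib]
      _ = ∑ τ ∈ S, (q τ * (m' τ - m τ) + (q τ - p τ) * (m τ - m τ₀) + (q τ - p τ) * m τ₀) :=
          sum_congr rfl fun τ _ => by ring
      _ = _ := by rw [sum_add_distrib, sum_add_distrib, h3, add_zero]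
  have hω0 : 0 ≤ ω := (abs_nonneg _).trans (hω τ₀ hτ₀ τ₀ hτ₀)
  rw [hsplit]
  refine (abs_add_le _ _).trans (add_le_add ?_ ?_)
  · calc |∑ τ ∈ S, q τ * (m' τ - m τ)| ≤ ∑ τ ∈ S, |q τ * (m' τ - m τ)| := abs_sum_le_sum_abs _ _
      _ ≤ ∑ τ ∈ S, q τ * η := sum_le_sum fun τ hτ => by
          rw [abs_mul, abs_of_nonneg (hq τ hτ)]; exact mul_le_mul_of_nonneg_left (hη τ hτ) (hq τ hτ)
      _ = η := by rw [← sum_mul, hq1, one_mul]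
  · calc |∑ τ ∈ S, (q τ - p τ) * (m τ - m τ₀)| ≤ ∑ τ ∈ S, |(q τ - p τ) * (m τ - m τ₀)| := abs_sum_le_sum_abs _ _
      _ ≤ ∑ τ ∈ S, |q τ - p τ| * ω := sum_le_sum fun τ hτ => by
          rw [abs_mul]; exact mul_le_mul_of_nonneg_left (hω τ hτ τ₀ hτ₀) (abs_nonneg _)
      _ ≤ 2 * ρ * ω := by rw [← sum_mul]; exact mul_le_mul_of_nonneg_right hρ hω0

end Sums

/-! ## §2 The unified descent road: fine binder + (conditional class-law TV) × (fibre oscillation) -/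

section Push

variable {ι κ : Type*} [DecidableEq κ] {Ω Ω' : ℕ → Type*} [∀ K, MeasurableSpace (Ω K)] [∀ K, MeasurableSpace (Ω' K)]
  {l₀ B : ℝ} {T : ℕ → Finset ι} {Bad : ℕ → ℝ → Finset ι} {f : ℕ → ι → κ} {Bad' : ℕ → ℝ → Finset κ}
  {F : ∀ K, Ω K → ℝ} {ν : ∀ K, ι → Measure (Ω K)} {F' : ∀ K, Ω' K → ℝ} {ν' : ∀ K, ι → Measure (Ω' K)}
  {A Bf : ℕ → ℝ → ι → ℝ} {η ω ρc : ℕ → ℝ}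

/-- ★★ **N14's BINDER DESCENDS AT RATE `η + 2ρᶜ·ω`.**  Fine data in MGF form with N14's fine binder `η`; a coarse bad policy under which the fine classes of a good coarse class are
good; positive fibre totals on the tilt window; run A's ONE-RUN fibre oscillation `ω_K` (FILE 7's letter); and the TWO-RUN per-set conditional class-law TV `ρᶜ_K` inside each good
coarse class (FILE 7's alternative letter).  THEN the pushed runs satisfy `TiltedMeanMatching l₀ (K ↦ (T K).image (f K)) Bad′ … (K ↦ η K + 2·ρᶜ K·ω K)` — FILE 7's two roads
(`η + ω`, `η + 2Bρᶜ`) are its corollaries. [folklore] -/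
theorem tiltedMeanMatching_push_of_condClassLawTV_mul_fibreOsc [DecidableEq ι] (hA : MGFForm B T F ν A) (hB : MGFForm B T F' ν' Bf)
    (hη : TiltedMeanMatching l₀ T Bad F ν F' ν' η)
    (hgood : ∀ (K : ℕ) (t : ℝ), |t| ≤ l₀ → ∀ τ ∈ T K, f K τ ∉ Bad' K t → τ ∉ Bad K t)
    (hpos : ∀ (K : ℕ) (t : ℝ), |t| ≤ l₀ → ∀ k ∈ (T K).image (f K) \ Bad' K t, ∀ s : ℝ, |s| ≤ l₀ →
      0 < ∑ τ ∈ (T K).filter (fun τ => f K τ = k), A K s τ ∧ 0 < ∑ τ ∈ (T K).filter (fun τ => f K τ = k), Bf K s τ)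
    (hω : ∀ (K : ℕ) (t : ℝ), |t| ≤ l₀ → ∀ k ∈ (T K).image (f K) \ Bad' K t,
      ∀ τ ∈ (T K).filter (fun τ => f K τ = k), ∀ τ' ∈ (T K).filter (fun τ => f K τ = k), ∀ s : ℝ, |s| ≤ l₀ →
        |tiltedMean (F K) (ν K τ) s - tiltedMean (F K) (ν K τ') s| ≤ ω K)
    (hρc : ∀ (K : ℕ) (t : ℝ), |t| ≤ l₀ → ∀ k ∈ (T K).image (f K) \ Bad' K t, ∀ s : ℝ, |s| ≤ l₀ → ∀ S ⊆ (T K).filter (fun τ => f K τ = k),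
      |(∑ τ ∈ S, A K s τ) / (∑ τ ∈ (T K).filter (fun τ => f K τ = k), A K s τ)
        - (∑ τ ∈ S, Bf K s τ) / (∑ τ ∈ (T K).filter (fun τ => f K τ = k), Bf K s τ)| ≤ ρc K) :
    TiltedMeanMatching l₀ (fun K => (T K).image (f K)) Bad' F (fun K k => ∑ τ ∈ (T K).filter (fun τ => f K τ = k), ν K τ) F'
      (fun K k => ∑ τ ∈ (T K).filter (fun τ => f K τ = k), ν' K τ) (fun K => η K + 2 * ρc K * ω K) := by
  intro K t ht k hk s hs
  obtain ⟨hZA, hZB⟩ := hpos K t ht k hk s hs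
  have hkBad : k ∉ Bad' K t := (mem_sdiff.mp hk).2
  set fib := (T K).filter (fun τ => f K τ = k) with hfib
  rw [tiltedMean_push_eq_condAvg hB K k hZB, tiltedMean_push_eq_condAvg hA K k hZA]
  refine abs_condAvg_sub_condAvg_le_of_tv_mul_osc (fun τ hτ => div_nonneg (hB.nonneg' K s (mem_filter.mp hτ).1) hZB.le)
    (by rw [← sum_div, div_self hZA.ne']) (by rw [← sum_div, div_self hZB.ne']) (fun τ hτ => ?_)
    (fun τ hτ τ' hτ' => hω K t ht k hk τ hτ τ' hτ' s hs) ?_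
  · obtain ⟨hτT, hτk⟩ := mem_filter.mp hτ
    exact hη K t ht τ (mem_sdiff.mpr ⟨hτT, hgood K t ht τ hτT (hτk ▸ hkBad)⟩) s hs
  · exact sum_abs_sub_le_two_mul_of_forall_subset fib (fun τ => A K s τ / ∑ σ ∈ fib, A K s σ) (fun τ => Bf K s τ / ∑ σ ∈ fib, Bf K s σ)
      fun S' hS' => by simpa only [sum_div] using hρc K t ht k hk s hs S' hS'

/-! ## §3 At the window key: FILE 11's tail, and the dichotomy «growth OR law merge» -/

variable {D : Type*} {vol E a : ℝ} {wf : ℕ → ι → Finset D} {sc : ℕ → D → ℕ} {Δ : ℕ → ℝ → ι → ℝ → D → ℝ} {win : ℕ → ℕ}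

/-- ★★★ **N14 AT THE WINDOW KEY, PRODUCT ROAD**: §2 with FILE 11's window ledger supplying `ω_K = 2volE·a^{j⋆(K)}∕(1−a)` (`fibreOsc_le_tail_of_windowLedger`): the pushed runs
satisfy `TiltedMeanMatching … (K ↦ η K + 2·ρᶜ K·(2·vol·E·a^{win K}∕(1−a)))` — fine binder, the two-run old-history law-merge letter `ρᶜ` and the one-run tail. [folklore] -/
theorem tiltedMeanMatching_window_of_fineBinder_of_condClassLawTV_of_windowLedger [DecidableEq ι] (hA : MGFForm B T F ν A)
    (hB : MGFForm B T F' ν' Bf) (hη : TiltedMeanMatching l₀ T Bad F ν F' ν' η)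
    (hgood : ∀ (K : ℕ) (t : ℝ), |t| ≤ l₀ → ∀ τ ∈ T K, f K τ ∉ Bad' K t → τ ∉ Bad K t)
    (hpos : ∀ (K : ℕ) (t : ℝ), |t| ≤ l₀ → ∀ k ∈ (T K).image (f K) \ Bad' K t, ∀ s : ℝ, |s| ≤ l₀ →
      0 < ∑ τ ∈ (T K).filter (fun τ => f K τ = k), A K s τ ∧ 0 < ∑ τ ∈ (T K).filter (fun τ => f K τ = k), Bf K s τ)
    (hwin : ∀ (K : ℕ) (t : ℝ), |t| ≤ l₀ → ∀ k ∈ (T K).image (f K) \ Bad' K t,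
      ∀ τ ∈ (T K).filter (fun τ => f K τ = k), ∀ τ' ∈ (T K).filter (fun τ => f K τ = k), ∀ s : ℝ, |s| ≤ l₀ →
        tiltedMean (F K) (ν K τ) s - tiltedMean (F K) (ν K τ') s
          = ∑ X ∈ (wf K τ) with sc K X + win K ≤ K, Δ K t τ s X - ∑ X ∈ (wf K τ') with sc K X + win K ≤ K, Δ K t τ' s X)
    (hqla : ∀ (K : ℕ) (t : ℝ), |t| ≤ l₀ → ∀ k ∈ (T K).image (f K) \ Bad' K t,
      ∀ τ ∈ (T K).filter (fun τ => f K τ = k), ∀ s : ℝ, |s| ≤ l₀ → QLa (wf K τ) (sc K) (Δ K t τ s) (fun _ => 0) K vol E a)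
    (hρc : ∀ (K : ℕ) (t : ℝ), |t| ≤ l₀ → ∀ k ∈ (T K).image (f K) \ Bad' K t, ∀ s : ℝ, |s| ≤ l₀ → ∀ S ⊆ (T K).filter (fun τ => f K τ = k),
      |(∑ τ ∈ S, A K s τ) / (∑ τ ∈ (T K).filter (fun τ => f K τ = k), A K s τ)
        - (∑ τ ∈ S, Bf K s τ) / (∑ τ ∈ (T K).filter (fun τ => f K τ = k), Bf K s τ)| ≤ ρc K)
    (hvol : 0 ≤ vol) (hE : 0 ≤ E) (ha0 : 0 ≤ a) (ha1 : a < 1) :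
    TiltedMeanMatching l₀ (fun K => (T K).image (f K)) Bad' F (fun K k => ∑ τ ∈ (T K).filter (fun τ => f K τ = k), ν K τ) F'
      (fun K k => ∑ τ ∈ (T K).filter (fun τ => f K τ = k), ν' K τ) (fun K => η K + 2 * ρc K * (2 * (vol * E * a ^ win K / (1 - a)))) :=
  tiltedMeanMatching_push_of_condClassLawTV_mul_fibreOsc hA hB hη hgood hpos (fibreOsc_le_tail_of_windowLedger hwin hqla hvol hE ha0 ha1) hρc

omit [DecidableEq κ] in
/-- ★ **THE DICHOTOMY**: the window rate `η_K + 2ρᶜ_K·(2volE·a^{j⋆(K)}∕(1−a))` is summable as soon as `Σ η < ∞`, `0 ≤ ρᶜ ≤ 1`, `vol, E ≥ 0`, `0 ≤ a < 1`, and EITHER the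
window grows enough (`Σ_K a^{j⋆(K)} < ∞` — FILE 11 `summable_pow_window_of_log_schedule`) OR the old-history conditional class laws of the two runs MERGE summably
(`Σ_K ρᶜ_K < ∞`) — for ANY window schedule, bounded included. [folklore] -/
theorem summable_windowRate_of_growth_or_lawMerge (hηs : Summable η) (hρ0 : ∀ K, 0 ≤ ρc K) (hρ1 : ∀ K, ρc K ≤ 1)
    (hvol : 0 ≤ vol) (hE : 0 ≤ E) (ha0 : 0 ≤ a) (ha1 : a < 1)
    (h : Summable (fun K : ℕ => a ^ win K) ∨ Summable ρc) :
    Summable (fun K => η K + 2 * ρc K * (2 * (vol * E * a ^ win K / (1 - a)))) := by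
  have h1a : 0 < 1 - a := sub_pos.mpr ha1
  refine hηs.add ?_
  have hb : ∀ K, 0 ≤ 2 * ρc K * (2 * (vol * E * a ^ win K / (1 - a))) := fun K => by
    have := hρ0 K; positivity
  rcases h with hg | hm
  · refine Summable.of_nonneg_of_le hb (fun K => ?_) (hg.mul_left (4 * vol * E / (1 - a)))
    have hx : 0 ≤ vol * E * a ^ win K / (1 - a) := by positivity
    calc 2 * ρc K * (2 * (vol * E * a ^ win K / (1 - a))) ≤ 2 * 1 * (2 * (vol * E * a ^ win K / (1 - a))) := by
          gcongr; exact hρ1 K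
      _ = 4 * vol * E / (1 - a) * a ^ win K := by ring
  · refine Summable.of_nonneg_of_le hb (fun K => ?_) (hm.mul_left (4 * vol * E / (1 - a)))
    have hpw : a ^ win K ≤ 1 := pow_le_one₀ ha0 ha1.le
    have hρK := hρ0 K
    calc 2 * ρc K * (2 * (vol * E * a ^ win K / (1 - a))) ≤ 2 * ρc K * (2 * (vol * E * 1 / (1 - a))) := by gcongr
      _ = 4 * vol * E / (1 - a) * ρc K := by ring

end Push

/-! ## §4 Sharpness: the two-run Dirac window toy — exact fine binder, bounded window, separated conditional laws, no summable coarse binder -/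

section Toy

/-- THE TOY's CONDITIONAL-AVERAGE MISMATCH.  Fibre `{+, −}`, fine class-wise tilted means `±S` for BOTH runs (fine binder exact: positive multiples of the same Dirac masses have the same tilted means — dag-n14-c `ConvexFibreMatching.tiltedMean_smul_measure`, FILE 11 `tiltedMean_dirac`), run A's conditional law `(1 − ε, ε)`,
run B's `(ε, 1 − ε)`: the coarse mismatch `Σ q·m′ − Σ p·m` (the two-term expansion of FILE 7's `tiltedMean_push_eq_condAvg` form of the window-keyed tilted means; the
fine means are FILE 11's `tiltedMean_dirac` values) EQUALS `−2(1 − 2ε)·S`. [folklore] -/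
theorem toy_condAvg_mismatch (ε S : ℝ) :
    (ε * S + (1 - ε) * (-S)) - ((1 - ε) * S + ε * (-S)) = -(2 * (1 - 2 * ε) * S) := by
  ring

/-- … its letters: the conditional laws are at ℓ¹-distance EXACTLY `2(1 − 2ε)` (SEPARATED for `ε < 1∕2`, no merge) and run A's fine means oscillate by EXACTLY `2|S|`;
§1's bound `η + 2ρ·ω = 0 + 2(1−2ε)·2|S|` is attained up to the factor `2`. [folklore] -/
theorem toy_letters {ε : ℝ} (hε : ε ≤ 1 / 2) (S : ℝ) :
    |ε - (1 - ε)| + |(1 - ε) - ε| = 2 * (1 - 2 * ε) ∧ |S - (-S)| = 2 * |S| := by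
  refine ⟨?_, ?_⟩
  · rw [abs_of_nonpos (by linarith), abs_of_nonneg (by linarith)]
    ring
  · rw [sub_neg_eq_add, ← two_mul, abs_mul, abs_two]

/-- ★ **A BOUNDED WINDOW WITHOUT LAW MERGE ADMITS NO SUMMABLE COARSE BINDER.**  Take `S_K` := FILE 11's old tail `Σ_{j + j⋆(K) ≤ K} E·b^{K−j}` (`E > 0`, `0 < b ≤ 1`), a
fixed separation `ε < 1∕2`, and a window bounded along a subsequence (`∃ᶠ K, j⋆(K) ≤ M`).  Then EVERY rate `r` bounding the toy's coarse mismatch,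
`|Σ q·m′ − Σ p·m| ≤ r K`, satisfies `2(1−2ε)·E·b^{j⋆(K)} ≤ r K` whenever `j⋆(K) ≤ K` (FILE 11 `le_dirac_ledger_tail`) and is NOT summable — while the fine binder is
exact and every letter of §2 other than «`Σρᶜ < ∞` or window growth» holds.  The N14 side of a bounded (1.80)-window therefore needs the old-history LAW-MERGE letter.
[folklore] -/
theorem not_summable_coarseBinder_of_dirac_window_toy {E b ε : ℝ} (hE : 0 < E) (hb0 : 0 < b) (hb1 : b ≤ 1) (hε : ε < 1 / 2)
    {win : ℕ → ℕ} {M : ℕ} (hM : ∃ᶠ K : ℕ in atTop, win K ≤ M) {r : ℕ → ℝ}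
    (hr : ∀ K : ℕ,
      |(ε * (∑ j ∈ range (K + 1) with j + win K ≤ K, E * b ^ (K - j)) + (1 - ε) * (-(∑ j ∈ range (K + 1) with j + win K ≤ K, E * b ^ (K - j))))
        - ((1 - ε) * (∑ j ∈ range (K + 1) with j + win K ≤ K, E * b ^ (K - j)) + ε * (-(∑ j ∈ range (K + 1) with j + win K ≤ K, E * b ^ (K - j))))|
        ≤ r K) :
    ¬ Summable r := by
  intro hs
  have hsep : 0 < 1 - 2 * ε := by linarith
  have hδ : 0 < 2 * (1 - 2 * ε) * (E * b ^ M) := by positivity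
  have hev : ∀ᶠ K : ℕ in atTop, r K < 2 * (1 - 2 * ε) * (E * b ^ M) := hs.tendsto_atTop_zero.eventually (gt_mem_nhds hδ)
  obtain ⟨K, hK, hlt, hMK⟩ := (hM.and_eventually (hev.and (eventually_ge_atTop M))).exists
  have hwK : win K ≤ K := hK.trans hMK
  have htail := le_dirac_ledger_tail (w := win) hE.le hb0.le hwK
  have hlow : 2 * (1 - 2 * ε) * (E * b ^ win K) ≤ r K := by
    refine le_trans ?_ (hr K)
    rw [toy_condAvg_mismatch, abs_neg, abs_of_nonneg (by positivity)]
    gcongr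
  have hmono : b ^ M ≤ b ^ win K := pow_le_pow_of_le_one hb0.le hb1 hK
  have h2 : 2 * (1 - 2 * ε) * (E * b ^ M) ≤ 2 * (1 - 2 * ε) * (E * b ^ win K) := by gcongr
  linarith

end Toy

end YMDAG.N14.WindowDescentLawMerge

end
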